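import Mathlib
import Summits.Ventures.PercRepro2.TypedPendantRoot
import Summits.Ventures.PercRepro2.TypedPendantA3
import Summits.Ventures.PercRepro2.TypedPendantPair

/-!
# The Y-configuration of the equality locus of (PM-ROOT) is a caterpillar, and it is a theorem
(family A: `a₃ — u — x — a₂`, `x — (o·b)`, root at `u`; blind cell PercRepro2, mine-2 g52,
2026-08-29; `conjectures/MINE-2.md` M2-109)

The exceptions to the series-chain rule of the equality locus of (PM-ROOT) (M2-108 add. 3: 5,684
of 8,832,595 equality cases at 6–7 vertices) are, after night-3's leaf rules for `o` / `b` and the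
series contractions, instances of TWO six-vertex caterpillars: the root `a₁` pendant at `u`, `u`
carrying one class-`1` pendant mark and the edge `u–x` of class `1` or `2`, `x` carrying the
class-`1` pendant `a₂` and one further class-`1` pendant mark, the two pendant marks being `a₃`
and the PAIR `o = b` (a leaf carrying both marks).  This file proves family A (`a₃` at `u`, the
pair at `x`): **`caterpillarA_corner`** — `N₁ = N₃`, `N₂ = 2·N₃` and `N₃ = 2·C(2, c)` for the
class `c ∈ {1, 2}` of `u–x`.

Mechanism: the pendant-pair rule (`TypedPendantPair.lean`) reduces `K₃` to its same-slot part `KP`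
with the pair pinned at `x`; the pendant `a₂`, the pendant `a₃` and the pendant root are peeled by
the generic peel (`typedCount_peel_one/two/three`, the kills `killA2`, `kill3`, `killA1`), leaving
the single typed edge `u–x`; its two base states (`cat_st`: all marks joined, or `a₁ ~ a₃` against
`a₂ ~ (o·b)`) make the count a finite `Bool³`-sum (`caterpillarA_count`: `catVal (KC4 k) c`),
evaluated by `decide`: `(N₁, N₂, N₃) = (4, 8, 4)` at `c = 1` and `(2, 4, 2)` at `c = 2` — the
census values, reproduced by the kernel.  Own work; standard axioms.
-/

namespace Summit.Ventures.PercRepro2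

namespace CovForm

namespace TypedRed

open OneTyped TypedA3

/-! ## The caterpillar `a₃ — u — x — a₂`, `x — (o·b)`, root at `u`: the two base states -/

section CaterpillarStates

open Classical

variable {V : Type*} {E : Type*} [DecidableEq E]
variable (ends : E → Sym2 V) (a₁ a₂ a₃ u x w : V)

/-- The state of a copy of the caterpillar with all five edges open. -/
def catOpen : St := (true, true, true, true, true, true, true)

/-- The state of a copy of the caterpillar with `u–x` closed and the four pendant edges open:
`a₁ ~ a₃`, `a₂ ~ (o·b)`, nothing across. -/
def catClosed : St := (false, false, true, false, true, true, false)

/-- A configuration of the caterpillar with the four pendant edges open, `u–x` in state `p`, and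
every other edge at `u` and at `x` closed: the connections among the marks. -/
lemma cat_st {f e₃ ex g₂ gp : E} (hf : ends f = s(a₁, u)) (he₃ : ends e₃ = s(a₃, u))
    (hex : ends ex = s(u, x)) (hg₂ : ends g₂ = s(a₂, x)) (hgp : ends gp = s(w, x))
    (hleaf1 : ∀ e, a₁ ∈ ends e → e = f) (hleaf3 : ∀ e, a₃ ∈ ends e → e = e₃)
    (h1u : a₁ ≠ u) (h2u : a₂ ≠ u) (h23 : a₂ ≠ a₃) (h3u : a₃ ≠ u) (h12 : a₁ ≠ a₂) (h13 : a₁ ≠ a₃)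
    (hwu : w ≠ u) (hw1 : w ≠ a₁) (hw3 : w ≠ a₃)
    (ω : Config E) (hωf : ω f = true) (hωe₃ : ω e₃ = true) (hωg₂ : ω g₂ = true)
    (hωgp : ω gp = true) (hclu : ∀ e, e ≠ f → e ≠ e₃ → e ≠ ex → u ∈ ends e → ω e = false)
    (p : Bool) (hωex : ω ex = p) :
    st ends w a₁ a₂ a₃ w ω = cond p catOpen catClosed := by
  have c1u : Conn ends ω a₁ u := conn_of_openAdj ⟨f, hωf, hf⟩
  have c3u : Conn ends ω a₃ u := conn_of_openAdj ⟨e₃, hωe₃, he₃⟩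
  have c2x : Conn ends ω a₂ x := conn_of_openAdj ⟨g₂, hωg₂, hg₂⟩
  have cwx : Conn ends ω w x := conn_of_openAdj ⟨gp, hωgp, hgp⟩
  have c13 : Conn ends ω a₁ a₃ := conn_trans c1u (conn_symm c3u)
  have c2w : Conn ends ω a₂ w := conn_trans c2x (conn_symm cwx)
  cases p
  · -- `u–x` closed: `{a₁, u, a₃}` is closed under open adjacency
    have hS : ∀ p ∈ ({a₁, u, a₃} : Set V), ∀ q, (openGraph ends ω).Adj p q →
        q ∈ ({a₁, u, a₃} : Set V) := by
      intro p hp q hpq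
      rw [openGraph_adj] at hpq
      obtain ⟨-, e, he, hends⟩ := hpq
      simp only [Set.mem_insert_iff, Set.mem_singleton_iff] at hp ⊢
      rcases hp with rfl | rfl | rfl
      · have hef : e = f := hleaf1 e (by rw [hends]; exact Sym2.mem_mk_left _ _)
        subst hef
        rw [hf, Sym2.eq_iff] at hends
        rcases hends with ⟨-, h⟩ | ⟨h, -⟩
        · exact Or.inr (Or.inl h.symm)
        · exact Or.inl h.symm
      · by_cases hef : e = f
        · subst hef
          rw [hf, Sym2.eq_iff] at hends
          rcases hends with ⟨h, -⟩ | ⟨h, -⟩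
          · exact absurd h h1u
          · exact Or.inl h.symm
        · by_cases hee₃ : e = e₃
          · subst hee₃
            rw [he₃, Sym2.eq_iff] at hends
            rcases hends with ⟨h, -⟩ | ⟨h, -⟩
            · exact absurd h h3u
            · exact Or.inr (Or.inr h.symm)
          · by_cases heex : e = ex
            · subst heex
              rw [hωex] at he
              exact absurd he Bool.false_ne_true
            · have := hclu e hef hee₃ heex (by rw [hends]; exact Sym2.mem_mk_left _ _)
              rw [this] at he
              exact absurd he Bool.false_ne_true
      · have hee₃ : e = e₃ := hleaf3 e (by rw [hends]; exact Sym2.mem_mk_left _ _)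
        subst hee₃
        rw [he₃, Sym2.eq_iff] at hends
        rcases hends with ⟨-, h⟩ | ⟨h, -⟩
        · exact Or.inr (Or.inl h.symm)
        · exact Or.inr (Or.inr h.symm)
    have hmem : ∀ v, Conn ends ω a₁ v → v ∈ ({a₁, u, a₃} : Set V) :=
      fun v hv => mem_of_conn_of_closed hS (by simp) hv
    have hmem3 : ∀ v, Conn ends ω a₃ v → v ∈ ({a₁, u, a₃} : Set V) :=
      fun v hv => mem_of_conn_of_closed hS (by simp) hv
    have n21 : ¬ Conn ends ω a₂ a₁ := fun h => by
      have := hmem a₂ (conn_symm h)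
      simp only [Set.mem_insert_iff, Set.mem_singleton_iff] at this
      rcases this with h | h | h
      · exact h12 h.symm
      · exact h2u h
      · exact h23 h
    have n1w : ¬ Conn ends ω a₁ w := fun h => by
      have := hmem w h
      simp only [Set.mem_insert_iff, Set.mem_singleton_iff] at this
      rcases this with h | h | h
      · exact hw1 h
      · exact hwu h
      · exact hw3 h
    have n23 : ¬ Conn ends ω a₂ a₃ := fun h => by
      have := hmem3 a₂ (conn_symm h)
      simp only [Set.mem_insert_iff, Set.mem_singleton_iff] at this
      rcases this with h | h | h
      · exact h12 h.symm
      · exact h2u h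
      · exact h23 h
    unfold st catClosed
    simp only [cond_false, Prod.mk.injEq]
    exact ⟨decide_eq_false n21, decide_eq_false n1w, decide_eq_true c2w, decide_eq_false n1w,
      decide_eq_true c2w, decide_eq_true c13, decide_eq_false n23⟩
  · -- `u–x` open: everything is connected
    have cux : Conn ends ω u x := conn_of_openAdj ⟨ex, hωex, hex⟩
    have c1x : Conn ends ω a₁ x := conn_trans c1u cux
    have c21 : Conn ends ω a₂ a₁ := conn_trans c2x (conn_symm c1x)
    have c1w : Conn ends ω a₁ w := conn_trans c1x (conn_symm cwx)
    have c23 : Conn ends ω a₂ a₃ := conn_trans c21 c13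
    unfold st catOpen
    simp only [cond_true, Prod.mk.injEq]
    exact ⟨decide_eq_true c21, decide_eq_true c1w, decide_eq_true c2w, decide_eq_true c1w,
      decide_eq_true c2w, decide_eq_true c13, decide_eq_true c23⟩

end CaterpillarStates

/-! ## The peel chain and the corner -/

section CaterpillarA

open Classical

variable {V : Type*} {E : Type*} [Fintype E] [DecidableEq E] {R : Type*} [Field R]
variable (ends : E → Sym2 V) (a₁ a₂ a₃ u x w : V)

/-- The kernel after peeling the pair (`KP`) and the pendant `a₂` (class `1`). -/
def KC2 (x y z : St) : ℤ :=
  KP x (killA2 y) (killA2 z) + KP (killA2 x) y (killA2 z) + KP (killA2 x) (killA2 y) z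

/-- ... and the pendant `a₃` (class `1`). -/
def KC3 (x y z : St) : ℤ :=
  KC2 x (kill3 y) (kill3 z) + KC2 (kill3 x) y (kill3 z) + KC2 (kill3 x) (kill3 y) z

/-- ... and the pendant root `a₁` of class `1`. -/
def KC4one (x y z : St) : ℤ :=
  KC3 x (killA1 y) (killA1 z) + KC3 (killA1 x) y (killA1 z) + KC3 (killA1 x) (killA1 y) z

/-- ... of class `2`. -/
def KC4two (x y z : St) : ℤ :=
  KC3 (killA1 x) y z + KC3 x (killA1 y) z + KC3 x y (killA1 z)

/-- The fully peeled kernel for the root edge of class `k` (`k = 3`: no kill). -/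
def KC4 (k : ℕ) : St → St → St → ℤ := if k = 1 then KC4one else if k = 2 then KC4two else KC3

/-- The value of a peeled kernel on the caterpillar: the `Bool³`-sum over the placements of the
edge `u–x` (class `c`) of the kernel on the two base states. -/
def catVal (K : St → St → St → ℤ) (c : ℕ) : ℤ :=
  ∑ p : Bool, ∑ q : Bool, ∑ r : Bool,
    if p.toNat + q.toNat + r.toNat = c then
      K (cond p catOpen catClosed) (cond q catOpen catClosed) (cond r catOpen catClosed) else 0

/-- **The caterpillar count**: on `a₃ —1— u —c— x —1— a₂`, `x —1— (o·b)` with the root `a₁` at `u`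
by the edge `f` of class `k ∈ {1, 2, 3}`, `u` and `x` carrying no other open edge, the typed count
of `K₃` is `catVal (KC4 k) c`. -/
theorem caterpillarA_count {f e₃ ex g₂ gp : E} (hf : ends f = s(a₁, u)) (he₃ : ends e₃ = s(a₃, u))
    (hex : ends ex = s(u, x)) (hg₂ : ends g₂ = s(a₂, x)) (hgp : ends gp = s(w, x))
    (hleaf1 : ∀ e, a₁ ∈ ends e → e = f) (hleaf3 : ∀ e, a₃ ∈ ends e → e = e₃)
    (hleaf2 : ∀ e, a₂ ∈ ends e → e = g₂) (hleafw : ∀ e, w ∈ ends e → e = gp)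
    (h1u : a₁ ≠ u) (h12 : a₁ ≠ a₂) (h13 : a₁ ≠ a₃) (h1w : a₁ ≠ w) (h2u : a₂ ≠ u) (h2x : a₂ ≠ x)
    (h23 : a₂ ≠ a₃) (h2w : a₂ ≠ w) (h3u : a₃ ≠ u) (h3w : a₃ ≠ w) (hwu : w ≠ u) (hwx : w ≠ x)
    (hux : u ≠ x)
    (hfe₃ : f ≠ e₃) (hfex : f ≠ ex) (hfg₂ : f ≠ g₂) (hfgp : f ≠ gp) (he₃ex : e₃ ≠ ex)
    (he₃g₂ : e₃ ≠ g₂) (he₃gp : e₃ ≠ gp) (hexg₂ : ex ≠ g₂) (hexgp : ex ≠ gp) (hg₂gp : g₂ ≠ gp)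
    (F : Finset E) (hF : ∀ e ∈ F, e = f ∨ e = e₃ ∨ e = ex ∨ e = g₂ ∨ e = gp) (hfF : f ∈ F)
    (he₃F : e₃ ∈ F) (hexF : ex ∈ F) (hg₂F : g₂ ∈ F) (hgpF : gp ∈ F) (z : Config E)
    (hclu : ∀ e, e ≠ f → e ≠ e₃ → e ≠ ex → u ∈ ends e → z e = false)
    (τ : E → ℕ) (hτ3 : τ e₃ = 1) (hτ2 : τ g₂ = 1) (hτp : τ gp = 1) (k : ℕ)
    (hk : k = 1 ∨ k = 2 ∨ k = 3) :
    typedCount F z (Function.update τ f k)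
        (K3 ends w a₁ a₂ a₃ w : Config E → Config E → Config E → R) =
      ((catVal (KC4 k) (τ ex) : ℤ) : R) := by
  set τ' := Function.update τ f k with hτ'
  set S := st ends w a₁ a₂ a₃ w with hS
  have hτ'p : τ' gp = 1 := by rw [hτ', Function.update_of_ne hfgp.symm]; exact hτp
  have hτ'2 : τ' g₂ = 1 := by rw [hτ', Function.update_of_ne hfg₂.symm]; exact hτ2
  have hτ'3 : τ' e₃ = 1 := by rw [hτ', Function.update_of_ne hfe₃.symm]; exact hτ3
  have hτ'f : τ' f = k := by rw [hτ', Function.update_self]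
  have hτ'x : τ' ex = τ ex := by rw [hτ', Function.update_of_ne hfex.symm]
  -- the kill hypotheses of the three pendant marks
  have hst2 : ∀ (x : Config E) (p : Bool), S (Function.update x g₂ p) =
      cond p (S (Function.update x g₂ true)) (killA2 (S (Function.update x g₂ true))) := by
    intro x p
    cases p
    · exact st_update_pendant_a2 ends w a₁ a₂ a₃ w hg₂ hleaf2 h2x h2w h12.symm h23 h2w x
    · rfl
  have hst3 : ∀ (x : Config E) (p : Bool), S (Function.update x e₃ p) =
      cond p (S (Function.update x e₃ true)) (kill3 (S (Function.update x e₃ true))) := by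
    intro x p
    cases p
    · exact st_update_pendant_a3 ends w a₁ a₂ a₃ w he₃ hleaf3 h3u h3w h13.symm h23.symm h3w x
    · rfl
  have hst1 : ∀ (x : Config E) (p : Bool), S (Function.update x f p) =
      cond p (S (Function.update x f true)) (killA1 (S (Function.update x f true))) := by
    intro x p
    cases p
    · exact st_update_pendant_a1 ends w a₁ a₂ a₃ w hf hleaf1 h1u h1w h12 h13 h1w x
    · rfl
  -- step 1: the pair
  rw [typedCount_pendant_pair_one ends a₁ a₂ a₃ w hgp hleafw hwx h1w.symm h2w.symm h3w.symm F hgpF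
    z τ' hτ'p]
  -- step 2: the pendant `a₂`
  rw [typedCount_peel_one KP killA2 S hst2 (F.erase gp)
    (Finset.mem_erase.2 ⟨hg₂gp, hg₂F⟩) _ τ' hτ'2]
  have e2 : (fun x y w' => ((KP (S x) (killA2 (S y)) (killA2 (S w')) +
      KP (killA2 (S x)) (S y) (killA2 (S w')) + KP (killA2 (S x)) (killA2 (S y)) (S w') : ℤ) : R)) =
      fun x y w' => ((KC2 (S x) (S y) (S w') : ℤ) : R) := rfl
  rw [e2]
  -- step 3: the pendant `a₃`
  rw [typedCount_peel_one KC2 kill3 S hst3 ((F.erase gp).erase g₂)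
    (Finset.mem_erase.2 ⟨he₃g₂, Finset.mem_erase.2 ⟨he₃gp, he₃F⟩⟩) _ τ' hτ'3]
  have e3 : (fun x y w' => ((KC2 (S x) (kill3 (S y)) (kill3 (S w')) +
      KC2 (kill3 (S x)) (S y) (kill3 (S w')) + KC2 (kill3 (S x)) (kill3 (S y)) (S w') : ℤ) : R)) =
      fun x y w' => ((KC3 (S x) (S y) (S w') : ℤ) : R) := rfl
  rw [e3]
  -- the remaining typed edge set is `{ex}`
  have hfF3 : f ∈ ((F.erase gp).erase g₂).erase e₃ :=
    Finset.mem_erase.2 ⟨hfe₃, Finset.mem_erase.2 ⟨hfg₂, Finset.mem_erase.2 ⟨hfgp, hfF⟩⟩⟩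
  have hF4 : (((F.erase gp).erase g₂).erase e₃).erase f = {ex} := by
    ext e
    simp only [Finset.mem_erase, Finset.mem_singleton]
    constructor
    · rintro ⟨hef, hee₃, heg₂, hegp, heF⟩
      rcases hF e heF with h | h | h | h | h
      · exact absurd h hef
      · exact absurd h hee₃
      · exact h
      · exact absurd h heg₂
      · exact absurd h hegp
    · rintro rfl
      exact ⟨hfex.symm, he₃ex.symm, hexg₂, hexgp, hexF⟩
  -- the pinned configuration after the four peels, and the two base states
  set z₄ : Config E := Function.update (Function.update (Function.update (Function.update z gp true)
    g₂ true) e₃ true) f true with hz₄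
  have hst4 : ∀ p : Bool, S (Function.update (Function.update z₄ ex false) ex p) =
      cond p catOpen catClosed := by
    intro p
    rw [Function.update_idem, hS]
    refine cat_st ends a₁ a₂ a₃ u x w hf he₃ hex hg₂ hgp hleaf1 hleaf3 h1u h2u h23 h3u h12 h13
      hwu h1w.symm h3w.symm _ ?_ ?_ ?_ ?_ ?_ p (Function.update_self ex p z₄)
    · rw [Function.update_of_ne hfex, hz₄, Function.update_self]
    · rw [Function.update_of_ne he₃ex, hz₄, Function.update_of_ne hfe₃.symm, Function.update_self]
    · rw [Function.update_of_ne hexg₂.symm, hz₄, Function.update_of_ne hfg₂.symm,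
        Function.update_of_ne he₃g₂.symm, Function.update_self]
    · rw [Function.update_of_ne hexgp.symm, hz₄, Function.update_of_ne hfgp.symm,
        Function.update_of_ne he₃gp.symm, Function.update_of_ne hg₂gp.symm, Function.update_self]
    · intro e hef hee₃ heex hue
      by_cases heg₂ : e = g₂
      · subst heg₂
        rw [hg₂, Sym2.mem_iff] at hue
        rcases hue with h | h
        · exact absurd h.symm h2u
        · exact absurd h hux
      · by_cases hegp : e = gp
        · subst hegp
          rw [hgp, Sym2.mem_iff] at hue
          rcases hue with h | h
          · exact absurd h.symm hwu
          · exact absurd h hux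
        · rw [Function.update_of_ne heex, hz₄, Function.update_of_ne hef, Function.update_of_ne hee₃,
            Function.update_of_ne heg₂, Function.update_of_ne hegp]
          exact hclu e hef hee₃ heex hue
  -- step 4: the pendant root of class `k`, then the split at `u–x`
  have final : ∀ K : St → St → St → ℤ,
      typedCount ({ex} : Finset E) z₄ τ' (fun x y w' => ((K (S x) (S y) (S w') : ℤ) : R)) =
        ((catVal K (τ ex) : ℤ) : R) := by
    intro K
    rw [typedCount_split {ex} ex (Finset.mem_singleton_self ex), Finset.erase_singleton, hτ'x]
    simp only [typedCount_empty, hst4]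
    unfold catVal
    push_cast
    rfl
  rcases hk with rfl | rfl | rfl
  · rw [typedCount_peel_one KC3 killA1 S hst1 _ hfF3 _ τ' hτ'f, hF4]
    have e4 : (fun x y w' => ((KC3 (S x) (killA1 (S y)) (killA1 (S w')) +
        KC3 (killA1 (S x)) (S y) (killA1 (S w')) + KC3 (killA1 (S x)) (killA1 (S y)) (S w') : ℤ) : R)) =
        fun x y w' => ((KC4one (S x) (S y) (S w') : ℤ) : R) := rfl
    rw [e4, final KC4one]
    rfl
  · rw [typedCount_peel_two KC3 killA1 S hst1 _ hfF3 _ τ' hτ'f, hF4]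
    have e4 : (fun x y w' => ((KC3 (killA1 (S x)) (S y) (S w') +
        KC3 (S x) (killA1 (S y)) (S w') + KC3 (S x) (S y) (killA1 (S w')) : ℤ) : R)) =
        fun x y w' => ((KC4two (S x) (S y) (S w') : ℤ) : R) := rfl
    rw [e4, final KC4two]
    rfl
  · rw [typedCount_peel_three KC3 killA1 S hst1 _ hfF3 _ τ' hτ'f, hF4, final KC3]
    rfl

end CaterpillarA

/-! ## The values and the corner -/

section Corner

/-- `u–x` of class `1`, root of class `1`. -/
lemma catVal_one_one : catVal (KC4 1) 1 = 4 := by decide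
/-- `u–x` of class `1`, root of class `2`. -/
lemma catVal_two_one : catVal (KC4 2) 1 = 8 := by decide
/-- `u–x` of class `1`, root of class `3`. -/
lemma catVal_three_one : catVal (KC4 3) 1 = 4 := by decide
/-- `u–x` of class `2`, root of class `1`. -/
lemma catVal_one_two : catVal (KC4 1) 2 = 2 := by decide
/-- `u–x` of class `2`, root of class `2`. -/
lemma catVal_two_two : catVal (KC4 2) 2 = 4 := by decide
/-- `u–x` of class `2`, root of class `3`. -/
lemma catVal_three_two : catVal (KC4 3) 2 = 2 := by decide

variable {V : Type*} {E : Type*} [Fintype E] [DecidableEq E] {R : Type*} [Field R]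
variable (ends : E → Sym2 V) (a₁ a₂ a₃ u x w : V)

/-- **The caterpillar corner (family A)**: on `a₃ —1— u —c— x —1— a₂`, `x —1— (o·b)` with the
root `a₁` pendant at `u` and `c ∈ {1, 2}`, the typed bases of the root edge sit on the mark-like
corner of (PM-ROOT): `N₁ = N₃`, `N₂ = 2·N₃`, with `N₃ = 2·C(2, c)` (`4` for `c = 1`, `2` for
`c = 2`). -/
theorem caterpillarA_corner {f e₃ ex g₂ gp : E} (hf : ends f = s(a₁, u))
    (he₃ : ends e₃ = s(a₃, u)) (hex : ends ex = s(u, x)) (hg₂ : ends g₂ = s(a₂, x))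
    (hgp : ends gp = s(w, x))
    (hleaf1 : ∀ e, a₁ ∈ ends e → e = f) (hleaf3 : ∀ e, a₃ ∈ ends e → e = e₃)
    (hleaf2 : ∀ e, a₂ ∈ ends e → e = g₂) (hleafw : ∀ e, w ∈ ends e → e = gp)
    (h1u : a₁ ≠ u) (h12 : a₁ ≠ a₂) (h13 : a₁ ≠ a₃) (h1w : a₁ ≠ w) (h2u : a₂ ≠ u) (h2x : a₂ ≠ x)
    (h23 : a₂ ≠ a₃) (h2w : a₂ ≠ w) (h3u : a₃ ≠ u) (h3w : a₃ ≠ w) (hwu : w ≠ u) (hwx : w ≠ x)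
    (hux : u ≠ x)
    (hfe₃ : f ≠ e₃) (hfex : f ≠ ex) (hfg₂ : f ≠ g₂) (hfgp : f ≠ gp) (he₃ex : e₃ ≠ ex)
    (he₃g₂ : e₃ ≠ g₂) (he₃gp : e₃ ≠ gp) (hexg₂ : ex ≠ g₂) (hexgp : ex ≠ gp) (hg₂gp : g₂ ≠ gp)
    (F : Finset E) (hF : ∀ e ∈ F, e = f ∨ e = e₃ ∨ e = ex ∨ e = g₂ ∨ e = gp) (hfF : f ∈ F)
    (he₃F : e₃ ∈ F) (hexF : ex ∈ F) (hg₂F : g₂ ∈ F) (hgpF : gp ∈ F) (z : Config E)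
    (hclu : ∀ e, e ≠ f → e ≠ e₃ → e ≠ ex → u ∈ ends e → z e = false)
    (τ : E → ℕ) (hτ3 : τ e₃ = 1) (hτ2 : τ g₂ = 1) (hτp : τ gp = 1) (hτx : τ ex = 1 ∨ τ ex = 2) :
    typedCount F z (Function.update τ f 1)
          (K3 ends w a₁ a₂ a₃ w : Config E → Config E → Config E → R) =
        typedCount F z (Function.update τ f 3) (K3 ends w a₁ a₂ a₃ w) ∧
      typedCount F z (Function.update τ f 2)
          (K3 ends w a₁ a₂ a₃ w : Config E → Config E → Config E → R) =
        2 * typedCount F z (Function.update τ f 3) (K3 ends w a₁ a₂ a₃ w) ∧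
      typedCount F z (Function.update τ f 3)
          (K3 ends w a₁ a₂ a₃ w : Config E → Config E → Config E → R) =
        2 * (Nat.choose 2 (τ ex) : R) := by
  have h1 := caterpillarA_count (R := R) ends a₁ a₂ a₃ u x w hf he₃ hex hg₂ hgp hleaf1 hleaf3
    hleaf2 hleafw h1u h12 h13 h1w h2u h2x h23 h2w h3u h3w hwu hwx hux hfe₃ hfex hfg₂ hfgp he₃ex
    he₃g₂ he₃gp hexg₂ hexgp hg₂gp F hF hfF he₃F hexF hg₂F hgpF z hclu τ hτ3 hτ2 hτp 1
    (Or.inl rfl)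
  have h2 := caterpillarA_count (R := R) ends a₁ a₂ a₃ u x w hf he₃ hex hg₂ hgp hleaf1 hleaf3
    hleaf2 hleafw h1u h12 h13 h1w h2u h2x h23 h2w h3u h3w hwu hwx hux hfe₃ hfex hfg₂ hfgp he₃ex
    he₃g₂ he₃gp hexg₂ hexgp hg₂gp F hF hfF he₃F hexF hg₂F hgpF z hclu τ hτ3 hτ2 hτp 2
    (Or.inr (Or.inl rfl))
  have h3 := caterpillarA_count (R := R) ends a₁ a₂ a₃ u x w hf he₃ hex hg₂ hgp hleaf1 hleaf3
    hleaf2 hleafw h1u h12 h13 h1w h2u h2x h23 h2w h3u h3w hwu hwx hux hfe₃ hfex hfg₂ hfgp he₃ex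
    he₃g₂ he₃gp hexg₂ hexgp hg₂gp F hF hfF he₃F hexF hg₂F hgpF z hclu τ hτ3 hτ2 hτp 3
    (Or.inr (Or.inr rfl))
  rw [h1, h2, h3]
  rcases hτx with hc | hc
  · rw [hc, catVal_one_one, catVal_two_one, catVal_three_one]
    norm_num
  · rw [hc, catVal_one_two, catVal_two_two, catVal_three_two]
    norm_num

end Corner

end TypedRed

end CovForm

end Summit.Ventures.PercRepro2
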